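import Literature.MathematicalPhysics.QuantumManyBody.DirichletBoxParseval
import Literature.MathematicalPhysics.QuantumManyBody.FreeDirichletGap
import HarnessLib

/-!
# The one-dimensional Dirichlet sine gap with a slab term

Topic `Literature/MathematicalPhysics/QuantumManyBody`, namespace `…BoseGas`; a consequence of
the sine Parseval identity and the diagonal Dirichlet form of `DirichletBoxParseval.lean`
(`tsum_enorm_sq_integral_sinMode_mul`, `tsum_waveNumber_sq_mul_enorm_sq_integral_sinMode_mul`:
`∑ₙ |⟨sₙ, f⟩|² = ∫₀^L |f|²`, `∑ₙ (nπ/L)² |⟨sₙ, f⟩|² = ∫₀^L |f'|²` for the normalised sine modes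
`sₙ = (2/L)^{1/2} sin(nπ·/L)` and `f ∈ C¹[0,L]`, `f(0) = f(L) = 0`).  For such `f` and a slab
`(L - s, L]` at the right end (`0 < s ≤ L`), with `λ = (π/L)²`:

* `line_poincare` — `λ ∫₀^L |f|² ≤ ∫₀^L |f'|²` (the ground level);
* `line_gap_slab` — `3λ ∫_{L-s}^L |f|² + 2λ ∫₀^L |f|² ≤ (4π²s³/L³) λ ∫₀^L |f|² + 2 ∫₀^L |f'|²`:
  writing `f = c₁s₁ + r`, `c₁ = ⟨s₁, f⟩`, the sine gap gives `λ|c₁|² + 4λ‖r‖² ≤ ∫|f'|²`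
  (`‖r‖² = ‖f‖² - |c₁|²`, Pythagoras), while on the slab `|f|² ≤ 2|c₁|²s₁² + 2|r|²` and
  `∫_{L-s}^L s₁² ≤ (2/L)(π/L)² s³/3` (`sin(π(L-t)/L) ≤ π(L-t)/L`).

This is the one-coordinate engine of the statement that near-minimisers of the FREE Dirichlet
kinetic energy put `o(N)` particles into a slab of fixed width at a wall (the case of zero
scattering length of wall-depletion estimates): the excess kinetic energy above the ground level
controls the distance to the ground mode, whose slab mass is `O((s/L)³)`.  All statements in
`ℝ≥0∞`; no definitions.

## References

* [LSSY2005] E. H. Lieb, R. Seiringer, J. P. Solovej, J. Yngvason, *The Mathematics of the Bose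
  Gas and its Condensation* (2005), Ch. 2, (2.3) and after (2.50) (Dirichlet box levels).
-/

noncomputable section

namespace Literature.MathematicalPhysics.QuantumManyBody.BoseGas

open _root_.MeasureTheory _root_.Filter _root_.Set _root_.Real intervalIntegral Complex
open scoped ENNReal NNReal Topology BigOperators ComplexConjugate
open Literature.MathematicalPhysics.QuantumManyBody.NeumannBox
open Literature.MathematicalPhysics.QuantumManyBody.DirichletBox

/-! ### Elementary one-dimensional facts -/

/-- The `n = 0` sine coefficient vanishes. [folklore] -/
theorem sinCoeff_zero (L : ℝ) (f : ℝ → ℂ) :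
    ∫ t in (0 : ℝ)..L, ((Real.sqrt (2 / L) * Real.sin (waveNumber L 0 * t) : ℝ) : ℂ) * f t = 0 := by
  have : (fun t : ℝ => ((Real.sqrt (2 / L) * Real.sin (waveNumber L 0 * t) : ℝ) : ℂ) * f t) =
      fun _ => 0 := by
    funext t; simp [waveNumber]
  rw [this, intervalIntegral.integral_zero]

/-- `∫_{L-s}^L (2/L) sin²(πt/L) dt ≤ (2/L)(π/L)² s³/3` for `0 ≤ s ≤ L`, `L > 0`
(`sin(πt/L) = sin(π(L-t)/L) ≤ π(L-t)/L` on `[0, L]`). [folklore] -/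
theorem integral_slab_sinMode_sq_le {L s : ℝ} (hL : 0 < L) (hs : 0 ≤ s) (hsL : s ≤ L) :
    ∫ t in (L - s)..L, 2 / L * Real.sin (π * t / L) ^ 2 ≤ 2 / L * (π / L) ^ 2 * (s ^ 3 / 3) := by
  have hle : L - s ≤ L := by linarith
  have hpt : ∀ t ∈ Icc (L - s) L, 2 / L * Real.sin (π * t / L) ^ 2 ≤ 2 / L * ((π / L) ^ 2 * (L - t) ^ 2) := by
    intro t ht
    have h0 : 0 ≤ L - t := by linarith [ht.2]
    have h1 : Real.sin (π * t / L) = Real.sin (π * (L - t) / L) := by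
      rw [show π * (L - t) / L = π - π * t / L by
        rw [mul_sub, sub_div, mul_div_cancel_right₀ _ hL.ne'], Real.sin_pi_sub]
    have h2 : 0 ≤ π * (L - t) / L := by positivity
    have h3 : Real.sin (π * (L - t) / L) ≤ π * (L - t) / L := Real.sin_le h2
    have h4 : 0 ≤ Real.sin (π * (L - t) / L) := by
      refine Real.sin_nonneg_of_nonneg_of_le_pi h2 ?_
      rw [div_le_iff₀ hL]; nlinarith [ht.1, Real.pi_pos]
    rw [h1]
    refine mul_le_mul_of_nonneg_left ?_ (by positivity)
    calc Real.sin (π * (L - t) / L) ^ 2 ≤ (π * (L - t) / L) ^ 2 := pow_le_pow_left₀ h4 h3 2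
      _ = (π / L) ^ 2 * (L - t) ^ 2 := by ring
  have hint : ∫ t in (L - s)..L, 2 / L * ((π / L) ^ 2 * (L - t) ^ 2) = 2 / L * (π / L) ^ 2 * (s ^ 3 / 3) := by
    have hd : ∀ t ∈ uIcc (L - s) L, HasDerivAt (fun t => -((L - t) ^ 3 / 3)) ((L - t) ^ 2) t := by
      intro t _
      have h := ((hasDerivAt_id t).const_sub L).pow 3
      have h' := (h.div_const 3).neg
      refine h'.congr_deriv ?_
      simp only [id]; ring
    have h := integral_eq_sub_of_hasDerivAt hd ((by fun_prop : Continuous fun t : ℝ => (L - t) ^ 2).intervalIntegrable _ _)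
    rw [intervalIntegral.integral_const_mul, show (fun t => (π / L) ^ 2 * (L - t) ^ 2) =
      fun t => (π / L) ^ 2 * (L - t) ^ 2 from rfl, intervalIntegral.integral_const_mul, h]
    simp; ring
  calc ∫ t in (L - s)..L, 2 / L * Real.sin (π * t / L) ^ 2
      ≤ ∫ t in (L - s)..L, 2 / L * ((π / L) ^ 2 * (L - t) ^ 2) :=
        intervalIntegral.integral_mono_on hle ((by fun_prop : Continuous fun t : ℝ =>
          2 / L * Real.sin (π * t / L) ^ 2).intervalIntegrable _ _)
          ((by fun_prop : Continuous fun t : ℝ => 2 / L * ((π / L) ^ 2 * (L - t) ^ 2)).intervalIntegrable _ _) hpt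
    _ = _ := hint

/-- **Pythagoras for the first sine mode**: with `s₁ = (2/L)^{1/2} sin(π·/L)` and
`c₁ = ∫₀^L s₁ f`, `∫₀^L |f - c₁ s₁|² = ∫₀^L |f|² - |c₁|²` (`∫₀^L s₁² = 1`). [folklore] -/
theorem integral_norm_sq_sub_sinMode {L : ℝ} (hL : 0 < L) {f : ℝ → ℂ} (hf : Continuous f) :
    ∫ t in (0 : ℝ)..L, ‖f t - (∫ u in (0 : ℝ)..L, ((Real.sqrt (2 / L) * Real.sin (π * u / L) : ℝ) : ℂ) * f u) *
        ((Real.sqrt (2 / L) * Real.sin (π * t / L) : ℝ) : ℂ)‖ ^ 2 =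
      (∫ t in (0 : ℝ)..L, ‖f t‖ ^ 2) -
        ‖∫ u in (0 : ℝ)..L, ((Real.sqrt (2 / L) * Real.sin (π * u / L) : ℝ) : ℂ) * f u‖ ^ 2 := by
  set sm : ℝ → ℝ := fun t => Real.sqrt (2 / L) * Real.sin (π * t / L) with hsm
  have hsmc : Continuous sm := by simp only [hsm]; fun_prop
  set c : ℂ := ∫ u in (0 : ℝ)..L, ((sm u : ℝ) : ℂ) * f u with hc
  change ∫ t in (0 : ℝ)..L, ‖f t - c * ((sm t : ℝ) : ℂ)‖ ^ 2 = (∫ t in (0 : ℝ)..L, ‖f t‖ ^ 2) - ‖c‖ ^ 2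
  -- pointwise expansion of the square
  have hpt : ∀ t, ‖f t - c * ((sm t : ℝ) : ℂ)‖ ^ 2 =
      ‖f t‖ ^ 2 + ‖c‖ ^ 2 * sm t ^ 2 - 2 * (conj c * (((sm t : ℝ) : ℂ) * f t)).re := by
    intro t
    rw [Complex.sq_norm, Complex.sq_norm, Complex.normSq_sub, Complex.normSq_mul,
      Complex.normSq_ofReal, Complex.sq_norm]
    have : (f t * conj (c * ((sm t : ℝ) : ℂ))).re = (conj c * (((sm t : ℝ) : ℂ) * f t)).re := by
      rw [map_mul, Complex.conj_ofReal]
      simp only [Complex.mul_re, Complex.mul_im, Complex.conj_re, Complex.conj_im,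
        Complex.ofReal_re, Complex.ofReal_im]
      ring
    rw [this, pow_two (sm t)]
  simp_rw [hpt]
  have hi1 : IntervalIntegrable (fun t => ‖f t‖ ^ 2) volume 0 L :=
    ((hf.norm).pow 2).intervalIntegrable _ _
  have hi2 : IntervalIntegrable (fun t => ‖c‖ ^ 2 * sm t ^ 2) volume 0 L :=
    (continuous_const.mul (hsmc.pow 2)).intervalIntegrable _ _
  have hi3 : IntervalIntegrable (fun t => 2 * (conj c * (((sm t : ℝ) : ℂ) * f t)).re) volume 0 L := by
    refine (continuous_const.mul ?_).intervalIntegrable _ _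
    exact Complex.continuous_re.comp (continuous_const.mul ((continuous_ofReal.comp hsmc).mul hf))
  rw [intervalIntegral.integral_sub (hi1.add hi2) hi3, intervalIntegral.integral_add hi1 hi2,
    intervalIntegral.integral_const_mul, intervalIntegral.integral_const_mul]
  -- `∫ s₁² = 1`
  have hs1 : ∫ t in (0 : ℝ)..L, sm t ^ 2 = 1 := by
    have : (fun t => sm t ^ 2) = fun t => 2 / L * Real.sin (π * t / L) ^ 2 := by
      funext t; simp only [hsm]; rw [mul_pow, Real.sq_sqrt (by positivity)]
    rw [this]; exact integral_two_div_mul_sin_sq hL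
  -- `∫ Re = Re ∫` and `∫ conj c · g = conj c · ∫ g`
  have hre : ∫ t in (0 : ℝ)..L, (conj c * (((sm t : ℝ) : ℂ) * f t)).re =
      (conj c * c).re := by
    have hint : IntervalIntegrable (fun t => conj c * (((sm t : ℝ) : ℂ) * f t)) volume 0 L :=
      (continuous_const.mul ((continuous_ofReal.comp hsmc).mul hf)).intervalIntegrable _ _
    have h1 : ∫ t in (0 : ℝ)..L, (conj c * (((sm t : ℝ) : ℂ) * f t)).re =
        (∫ t in (0 : ℝ)..L, conj c * (((sm t : ℝ) : ℂ) * f t)).re := by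
      rw [intervalIntegral.integral_of_le hL.le, intervalIntegral.integral_of_le hL.le]
      exact integral_re (hint.1)
    rw [h1, intervalIntegral.integral_const_mul]
  rw [hs1, hre]
  have : (conj c * c).re = ‖c‖ ^ 2 := by
    rw [Complex.sq_norm, ← Complex.normSq_eq_conj_mul_self]; simp
  rw [this]; ring

/-! ### The gap inequalities on a line -/

section Line

variable {L : ℝ} {f f' : ℝ → ℂ}

/-- **The sine gap, coefficient form**: `4λ ∫₀^L|f|² ≤ ∫₀^L|f'|² + 3λ|c₁|²` for `f ∈ C¹[0,L]`,
`f(0) = f(L) = 0`, `λ = (π/L)²`, `c₁ = ⟨s₁, f⟩` (termwise on the Parseval sums: `n² ≥ 4` for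
`n ≥ 2`). [cite: LSSY2005, Ch. 2, after (2.50)] -/
theorem four_mul_gap_le (hL : 0 < L) (hf : ∀ x ∈ uIcc (0 : ℝ) L, HasDerivAt f (f' x) x)
    (hfc : Continuous f) (hf' : Continuous f') (h0 : f 0 = 0) (hL0 : f L = 0) :
    ENNReal.ofReal (4 * (π / L) ^ 2) * ∫⁻ t in Ioc 0 L, ‖f t‖ₑ ^ 2 ≤
      (∫⁻ t in Ioc 0 L, ‖f' t‖ₑ ^ 2) + ENNReal.ofReal (3 * (π / L) ^ 2) *
        ‖∫ t in (0 : ℝ)..L, ((Real.sqrt (2 / L) * Real.sin (waveNumber L 1 * t) : ℝ) : ℂ) * f t‖ₑ ^ 2 := by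
  classical
  set A : ℕ → ℝ≥0∞ := fun n =>
    ‖∫ t in (0 : ℝ)..L, ((Real.sqrt (2 / L) * Real.sin (waveNumber L n * t) : ℝ) : ℂ) * f t‖ₑ ^ 2 with hA
  have hP1 : ∑' n, A n = ∫⁻ t in Ioc 0 L, ‖f t‖ₑ ^ 2 := tsum_enorm_sq_integral_sinMode_mul hL hfc
  have hP2 : ∑' n, ENNReal.ofReal (waveNumber L n ^ 2) * A n = ∫⁻ t in Ioc 0 L, ‖f' t‖ₑ ^ 2 :=
    tsum_waveNumber_sq_mul_enorm_sq_integral_sinMode_mul hL hf hf' h0 hL0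
  have hA0 : A 0 = 0 := by
    simp only [hA]
    rw [sinCoeff_zero]; simp
  have hterm : ∀ n, ENNReal.ofReal (4 * (π / L) ^ 2) * A n ≤
      ENNReal.ofReal (waveNumber L n ^ 2) * A n + (if n = 1 then ENNReal.ofReal (3 * (π / L) ^ 2) * A 1 else 0) := by
    intro n
    rcases Nat.lt_trichotomy n 1 with h | rfl | h
    · have : n = 0 := by omega
      subst this; simp [hA0]
    · simp only [if_true]
      rw [← add_mul, ← ENNReal.ofReal_add (by positivity) (by positivity)]
      refine mul_le_mul_left (ENNReal.ofReal_le_ofReal (le_of_eq ?_)) _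
      simp [waveNumber]; ring
    · have hn1 : n ≠ 1 := by omega
      simp only [hn1, if_false, add_zero]
      refine mul_le_mul_left (ENNReal.ofReal_le_ofReal ?_) _
      have h2 : (2 : ℝ) ≤ n := by exact_mod_cast h
      rw [waveNumber, show (n : ℝ) * π / L = n * (π / L) by ring, mul_pow]
      have : (4 : ℝ) ≤ (n : ℝ) ^ 2 := by nlinarith
      nlinarith [sq_nonneg (π / L)]
  calc ENNReal.ofReal (4 * (π / L) ^ 2) * ∫⁻ t in Ioc 0 L, ‖f t‖ₑ ^ 2
      = ∑' n, ENNReal.ofReal (4 * (π / L) ^ 2) * A n := by rw [ENNReal.tsum_mul_left, hP1]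
    _ ≤ ∑' n, (ENNReal.ofReal (waveNumber L n ^ 2) * A n +
        (if n = 1 then ENNReal.ofReal (3 * (π / L) ^ 2) * A 1 else 0)) := ENNReal.tsum_le_tsum hterm
    _ = (∫⁻ t in Ioc 0 L, ‖f' t‖ₑ ^ 2) + ENNReal.ofReal (3 * (π / L) ^ 2) * A 1 := by
        rw [ENNReal.tsum_add, hP2, tsum_ite_eq]

/-- The mass of a continuous function on `(0, L]` is finite. [folklore] -/
theorem lintegral_Ioc_enorm_sq_ne_top (hL : 0 ≤ L) (hfc : Continuous f) :
    (∫⁻ t in Ioc 0 L, ‖f t‖ₑ ^ 2) ≠ ⊤ := by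
  rw [← ofReal_intervalIntegral_norm_sq hL hfc]; exact ENNReal.ofReal_ne_top

/-- **Poincaré on a line** (the ground level of the Dirichlet interval): `λ∫₀^L|f|² ≤ ∫₀^L|f'|²`,
`λ = (π/L)²`. [cite: LSSY2005, Ch. 2 (2.3)] -/
theorem line_poincare (hL : 0 < L) (hf : ∀ x ∈ uIcc (0 : ℝ) L, HasDerivAt f (f' x) x)
    (hfc : Continuous f) (hf' : Continuous f') (h0 : f 0 = 0) (hL0 : f L = 0) :
    ENNReal.ofReal ((π / L) ^ 2) * ∫⁻ t in Ioc 0 L, ‖f t‖ₑ ^ 2 ≤ ∫⁻ t in Ioc 0 L, ‖f' t‖ₑ ^ 2 := by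
  have h := four_mul_gap_le hL hf hfc hf' h0 hL0
  set M := ∫⁻ t in Ioc 0 L, ‖f t‖ₑ ^ 2 with hM
  set A1 := ‖∫ t in (0 : ℝ)..L, ((Real.sqrt (2 / L) * Real.sin (waveNumber L 1 * t) : ℝ) : ℂ) * f t‖ₑ ^ 2
  have hMT : M ≠ ⊤ := lintegral_Ioc_enorm_sq_ne_top hL.le hfc
  -- `A₁ ≤ M` (one term of the Parseval sum)
  have hA1M : A1 ≤ M := by
    rw [hM, ← tsum_enorm_sq_integral_sinMode_mul hL hfc]
    exact ENNReal.le_tsum 1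
  have h3 : ENNReal.ofReal (3 * (π / L) ^ 2) * M ≠ ⊤ := ENNReal.mul_ne_top ENNReal.ofReal_ne_top hMT
  refine ENNReal.le_of_add_le_add_right h3 ?_
  calc ENNReal.ofReal ((π / L) ^ 2) * M + ENNReal.ofReal (3 * (π / L) ^ 2) * M
      = ENNReal.ofReal (4 * (π / L) ^ 2) * M := by
        rw [← add_mul, ← ENNReal.ofReal_add (by positivity) (by positivity)]; ring_nf
    _ ≤ (∫⁻ t in Ioc 0 L, ‖f' t‖ₑ ^ 2) + ENNReal.ofReal (3 * (π / L) ^ 2) * A1 := h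
    _ ≤ _ := by gcongr

/-- **The sine gap with a slab term.**  For `f ∈ C¹[0,L]` (continuous on `ℝ`) with
`f(0) = f(L) = 0` and `0 < s ≤ L`, with `λ = (π/L)²`:
`3λ ∫_{L-s}^L |f|² + 2λ ∫₀^L |f|² ≤ (4π²s³/L³)λ ∫₀^L |f|² + 2∫₀^L |f'|²`.
[cite: LSSY2005, Ch. 2, (2.3) and after (2.50)] -/
theorem line_gap_slab (hL : 0 < L) (hf : ∀ x ∈ uIcc (0 : ℝ) L, HasDerivAt f (f' x) x)
    (hfc : Continuous f) (hf' : Continuous f') (h0 : f 0 = 0) (hL0 : f L = 0) {s : ℝ}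
    (hs : 0 ≤ s) (hsL : s ≤ L) :
    ENNReal.ofReal (3 * (π / L) ^ 2) * (∫⁻ t in Ioc (L - s) L, ‖f t‖ₑ ^ 2) +
        ENNReal.ofReal (2 * (π / L) ^ 2) * ∫⁻ t in Ioc 0 L, ‖f t‖ₑ ^ 2 ≤
      ENNReal.ofReal (4 * π ^ 2 * s ^ 3 / L ^ 3 * (π / L) ^ 2) * (∫⁻ t in Ioc 0 L, ‖f t‖ₑ ^ 2) +
        2 * ∫⁻ t in Ioc 0 L, ‖f' t‖ₑ ^ 2 := by
  -- the objects
  set lam : ℝ := (π / L) ^ 2 with hlam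
  have hlam0 : 0 < lam := by positivity
  set sm : ℝ → ℝ := fun t => Real.sqrt (2 / L) * Real.sin (π * t / L) with hsm
  have hsmc : Continuous sm := by simp only [hsm]; fun_prop
  have hsm1 : ∀ t, Real.sqrt (2 / L) * Real.sin (waveNumber L 1 * t) = sm t := by
    intro t; simp only [hsm, waveNumber, Nat.cast_one, one_mul]; ring_nf
  set c : ℂ := ∫ u in (0 : ℝ)..L, ((sm u : ℝ) : ℂ) * f u with hc
  set M := ∫⁻ t in Ioc 0 L, ‖f t‖ₑ ^ 2 with hM
  set T := ∫⁻ t in Ioc 0 L, ‖f' t‖ₑ ^ 2 with hT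
  set A1 : ℝ≥0∞ := ‖c‖ₑ ^ 2 with hA1
  set r : ℝ → ℂ := fun t => f t - c * ((sm t : ℝ) : ℂ) with hr
  have hrc : Continuous r := hfc.sub (continuous_const.mul (continuous_ofReal.comp hsmc))
  set Rm := ∫⁻ t in Ioc 0 L, ‖r t‖ₑ ^ 2 with hRm
  set Sl := ∫⁻ t in Ioc (L - s) L, ‖f t‖ₑ ^ 2 with hSl
  have hMT : M ≠ ⊤ := lintegral_Ioc_enorm_sq_ne_top hL.le hfc
  -- (1) the gap: `4λ M ≤ T + 3λ A₁`
  have hgap : ENNReal.ofReal (4 * lam) * M ≤ T + ENNReal.ofReal (3 * lam) * A1 := by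
    have h := four_mul_gap_le hL hf hfc hf' h0 hL0
    simp_rw [hsm1] at h
    exact h
  -- (2) Pythagoras: `Rm + A₁ = M`
  have hpyth : Rm + A1 = M := by
    have hreal : (∫ t in (0 : ℝ)..L, ‖f t - c * ((sm t : ℝ) : ℂ)‖ ^ 2) =
        (∫ t in (0 : ℝ)..L, ‖f t‖ ^ 2) - ‖c‖ ^ 2 := integral_norm_sq_sub_sinMode hL hfc
    have hRm' : Rm = ENNReal.ofReal (∫ t in (0 : ℝ)..L, ‖r t‖ ^ 2) :=
      (ofReal_intervalIntegral_norm_sq hL.le hrc).symm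
    have hM' : M = ENNReal.ofReal (∫ t in (0 : ℝ)..L, ‖f t‖ ^ 2) :=
      (ofReal_intervalIntegral_norm_sq hL.le hfc).symm
    have hA1' : A1 = ENNReal.ofReal (‖c‖ ^ 2) := by
      rw [hA1, ENNReal.ofReal_pow (norm_nonneg _), ofReal_norm]
    have hRnn : 0 ≤ ∫ t in (0 : ℝ)..L, ‖r t‖ ^ 2 :=
      intervalIntegral.integral_nonneg hL.le fun t _ => by positivity
    rw [hRm', hM', hA1', ← ENNReal.ofReal_add hRnn (by positivity)]
    congr 1
    rw [hreal]; ring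
  -- (3) the slab: `Sl ≤ 2 Rm + 2 κ A₁`, `κ = (2/L)λ s³/3`
  have hslab : Sl ≤ 2 * Rm + 2 * (ENNReal.ofReal (2 / L * lam * (s ^ 3 / 3)) * A1) := by
    have hpt : ∀ t, ‖f t‖ₑ ^ 2 ≤ 2 * ‖r t‖ₑ ^ 2 + 2 * (ENNReal.ofReal (sm t ^ 2) * A1) := by
      intro t
      have hft : f t = r t + c * ((sm t : ℝ) : ℂ) := by simp [hr]
      have h1 : ‖f t‖ ^ 2 ≤ 2 * ‖r t‖ ^ 2 + 2 * (sm t ^ 2 * ‖c‖ ^ 2) := by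
        rw [hft]
        calc ‖r t + c * ((sm t : ℝ) : ℂ)‖ ^ 2 ≤ (‖r t‖ + ‖c * ((sm t : ℝ) : ℂ)‖) ^ 2 :=
              pow_le_pow_left₀ (norm_nonneg _) (norm_add_le _ _) 2
          _ ≤ 2 * ‖r t‖ ^ 2 + 2 * ‖c * ((sm t : ℝ) : ℂ)‖ ^ 2 := by
              nlinarith [sq_nonneg (‖r t‖ - ‖c * ((sm t : ℝ) : ℂ)‖)]
          _ = 2 * ‖r t‖ ^ 2 + 2 * (sm t ^ 2 * ‖c‖ ^ 2) := by
              rw [norm_mul, Complex.norm_real, Real.norm_eq_abs, mul_pow, sq_abs]; ring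
      have h2 : ‖f t‖ₑ ^ 2 = ENNReal.ofReal (‖f t‖ ^ 2) := by
        rw [ENNReal.ofReal_pow (norm_nonneg _), ofReal_norm]
      have h3 : ‖r t‖ₑ ^ 2 = ENNReal.ofReal (‖r t‖ ^ 2) := by
        rw [ENNReal.ofReal_pow (norm_nonneg _), ofReal_norm]
      have h4 : A1 = ENNReal.ofReal (‖c‖ ^ 2) := by
        rw [hA1, ENNReal.ofReal_pow (norm_nonneg _), ofReal_norm]
      rw [h2, h3, h4, ← ENNReal.ofReal_mul (sq_nonneg _), ← ENNReal.ofReal_ofNat 2,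
        ← ENNReal.ofReal_mul (by norm_num), ← ENNReal.ofReal_mul (by norm_num),
        ← ENNReal.ofReal_add (by positivity) (by positivity)]
      exact ENNReal.ofReal_le_ofReal h1
    have hmeas_r : Measurable fun t => ‖r t‖ₑ ^ 2 := (hrc.measurable.enorm).pow_const 2
    have hmeas_s2 : Measurable fun t => ENNReal.ofReal (sm t ^ 2) :=
      (hsmc.pow 2).measurable.ennreal_ofReal
    have hmeas_s : Measurable fun t => ENNReal.ofReal (sm t ^ 2) * A1 := hmeas_s2.mul_const _
    calc Sl ≤ ∫⁻ t in Ioc (L - s) L, (2 * ‖r t‖ₑ ^ 2 + 2 * (ENNReal.ofReal (sm t ^ 2) * A1)) :=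
          lintegral_mono fun t => hpt t
      _ = 2 * (∫⁻ t in Ioc (L - s) L, ‖r t‖ₑ ^ 2) +
          2 * ((∫⁻ t in Ioc (L - s) L, ENNReal.ofReal (sm t ^ 2)) * A1) := by
          rw [lintegral_add_left (hmeas_r.const_mul _), lintegral_const_mul _ hmeas_r,
            lintegral_const_mul _ hmeas_s, lintegral_mul_const _ hmeas_s2]
      _ ≤ 2 * Rm + 2 * (ENNReal.ofReal (2 / L * lam * (s ^ 3 / 3)) * A1) := by
          gcongr
          · exact lintegral_mono_set (Ioc_subset_Ioc (by linarith) le_rfl)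
          · -- `∫_{L-s}^L s₁² ≤ (2/L) λ s³/3`
            have hcont : Continuous fun t => sm t ^ 2 := hsmc.pow 2
            rw [← ofReal_integral_eq_lintegral_ofReal (hcont.integrableOn_Ioc)
              (ae_of_all _ fun t => by positivity), ← intervalIntegral.integral_of_le (by linarith)]
            refine ENNReal.ofReal_le_ofReal ?_
            have : (fun t => sm t ^ 2) = fun t => 2 / L * Real.sin (π * t / L) ^ 2 := by
              funext t; simp only [hsm]; rw [mul_pow, Real.sq_sqrt (by positivity)]
            rw [this, hlam]
            exact integral_slab_sinMode_sq_le hL hs hsL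
  -- (4) algebra: from the gap and Pythagoras, `4λ Rm + λ A₁ ≤ T`
  have hA1T : A1 ≠ ⊤ := ne_top_of_le_ne_top hMT (by rw [← hpyth]; exact le_add_self)
  have hkey : ENNReal.ofReal (4 * lam) * Rm + ENNReal.ofReal lam * A1 ≤ T := by
    have h3 : ENNReal.ofReal (3 * lam) * A1 ≠ ⊤ := ENNReal.mul_ne_top ENNReal.ofReal_ne_top hA1T
    refine ENNReal.le_of_add_le_add_right h3 ?_
    calc ENNReal.ofReal (4 * lam) * Rm + ENNReal.ofReal lam * A1 + ENNReal.ofReal (3 * lam) * A1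
        = ENNReal.ofReal (4 * lam) * (Rm + A1) := by
          rw [mul_add, add_assoc, ← add_mul, ← ENNReal.ofReal_add (by positivity) (by positivity)]
          ring_nf
      _ = ENNReal.ofReal (4 * lam) * M := by rw [hpyth]
      _ ≤ T + ENNReal.ofReal (3 * lam) * A1 := hgap
  -- (5) conclusion
  have hA1M : A1 ≤ M := by rw [← hpyth]; exact le_add_self
  have hcoef : ENNReal.ofReal (3 * lam) * (2 * (ENNReal.ofReal (2 / L * lam * (s ^ 3 / 3)) * A1)) ≤
      ENNReal.ofReal (4 * π ^ 2 * s ^ 3 / L ^ 3 * lam) * M := by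
    have hid : 3 * lam * 2 * (2 / L * lam * (s ^ 3 / 3)) = 4 * π ^ 2 * s ^ 3 / L ^ 3 * lam := by
      rw [hlam]; field_simp; ring
    have h2 : ENNReal.ofReal (3 * lam * 2 * (2 / L * lam * (s ^ 3 / 3))) =
        ENNReal.ofReal (3 * lam) * 2 * ENNReal.ofReal (2 / L * lam * (s ^ 3 / 3)) := by
      rw [ENNReal.ofReal_mul (p := 3 * lam * 2) (by positivity),
        ENNReal.ofReal_mul (p := 3 * lam) (by positivity), ENNReal.ofReal_ofNat]
    calc ENNReal.ofReal (3 * lam) * (2 * (ENNReal.ofReal (2 / L * lam * (s ^ 3 / 3)) * A1))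
        = ENNReal.ofReal (3 * lam) * 2 * ENNReal.ofReal (2 / L * lam * (s ^ 3 / 3)) * A1 := by ring
      _ = ENNReal.ofReal (4 * π ^ 2 * s ^ 3 / L ^ 3 * lam) * A1 := by rw [← h2, hid]
      _ ≤ _ := by gcongr
  calc ENNReal.ofReal (3 * lam) * Sl + ENNReal.ofReal (2 * lam) * M
      ≤ ENNReal.ofReal (3 * lam) * (2 * Rm + 2 * (ENNReal.ofReal (2 / L * lam * (s ^ 3 / 3)) * A1)) +
          ENNReal.ofReal (2 * lam) * (Rm + A1) := by rw [hpyth]; gcongr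
    _ = ENNReal.ofReal (3 * lam) * (2 * (ENNReal.ofReal (2 / L * lam * (s ^ 3 / 3)) * A1)) +
          2 * (ENNReal.ofReal (4 * lam) * Rm + ENNReal.ofReal lam * A1) := by
          rw [show ENNReal.ofReal (4 * lam) = 4 * ENNReal.ofReal lam by
              rw [← ENNReal.ofReal_ofNat 4, ← ENNReal.ofReal_mul (by norm_num)],
            show ENNReal.ofReal (3 * lam) = 3 * ENNReal.ofReal lam by
              rw [← ENNReal.ofReal_ofNat 3, ← ENNReal.ofReal_mul (by norm_num)],
            show ENNReal.ofReal (2 * lam) = 2 * ENNReal.ofReal lam by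
              rw [← ENNReal.ofReal_ofNat 2, ← ENNReal.ofReal_mul (by norm_num)]]
          ring
    _ ≤ ENNReal.ofReal (4 * π ^ 2 * s ^ 3 / L ^ 3 * lam) * M + 2 * T := add_le_add hcoef (by gcongr)

end Line

end Literature.MathematicalPhysics.QuantumManyBody.BoseGas

end
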